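import Summits.NavierStokesRegularity.NavierStokesRegularity.Theses.AxisymmetricExtremality
import Literature.Analysis.FluidPDE.KNSSAxisymmetricNoSwirl

/-!
# Stub `stub_denseAngleClosure` of the line `birth`
# (crux `PFoldToAxisymmetric`, stmt-NavierStokesRegularity-15454, thesis `AxisymmetricExtremality`)

Closure of the dense subgroup in `L³`: if vector fields `V j ∈ L³(ℝ³; ℝ³)` are EXACTLY equivariant
under the rotation `R_{2π/q j}` (`Literature.Analysis.FluidPDE.rotZ (2π/q j)`) about the
`x 2`-axis, `q j → ∞`, and `V j → u` in `L³`, then `u` is almost-everywhere equivariant under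
`R_θ` for EVERY angle `θ`.  Pure measure theory / harmonic analysis; no Navier–Stokes.

Proof.  Reduce to `θ ≥ 0` by `2π`-periodicity of `rotZ`.  For `θ ≥ 0` put
`α j := ⌊θ q j / (2π)⌋₊ · (2π / q j)`, so `α j → θ` (`0 ≤ θ - α j ≤ 2π / q j` once `q j ≥ 1`), and
`V j` is equivariant under `R_{α j}` (iterate the hypothesis).  Then, with
`D(φ) := ‖u ∘ R_φ - R_φ ∘ u‖_{L³}`,
* `D(α j) ≤ ‖(u - V j) ∘ R_{α j}‖₃ + ‖R_{α j} ∘ (V j - u)‖₃ = 2 ‖V j - u‖₃` (rotations preserve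
  Lebesgue measure and are linear isometries);
* `‖u ∘ R_{α j} - u ∘ R_θ‖₃ → 0`: strong continuity of composition with a continuously varying
  measure-preserving map (Mathlib's `Filter.Tendsto.compMeasurePreservingLp`);
* `‖R_{α j} ∘ u - R_θ ∘ u‖₃ ≤ (|cos α j - cos θ| + |sin α j - sin θ|) ‖u‖₃ → 0`;
so `D(θ) ≤ 2‖V j - u‖₃ + o(1) → 0`, i.e. `D(θ) = 0`, which is the claim (`eLpNorm_eq_zero_iff`).
-/

noncomputable section

-- the summit and its single problem share the name (D-0017 nested layout)
set_option linter.dupNamespace false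

open MeasureTheory Filter Topology
open scoped ENNReal

namespace Summit.NavierStokesRegularity.NavierStokesRegularity.Theorems.PFoldToAxisymmetric.DenseAngleClosure

open Literature.Analysis.FluidPDE

/-! ### The rotations `rotZ`: iteration, periodicity, a Lipschitz bound in the angle -/

/-- A field equivariant under `R_a` is equivariant under every `R_{k a}`, `k : ℕ`. [folklore] -/
theorem equivariant_nat_mul {V : EuclideanSpace ℝ (Fin 3) → EuclideanSpace ℝ (Fin 3)} {a : ℝ}
    (hV : ∀ x, V (rotZ a x) = rotZ a (V x)) (k : ℕ) (x : EuclideanSpace ℝ (Fin 3)) :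
    V (rotZ (k * a) x) = rotZ (k * a) (V x) := by
  induction k generalizing x with
  | zero => simp
  | succ k ih =>
    have h : ((k + 1 : ℕ) : ℝ) * a = a + k * a := by push_cast; ring
    rw [h, rotZ_add, hV, ih, ← rotZ_add]

/-- `2π`-periodicity of the rotations in the angle: `R_{θ + 2πn} = R_θ`. [folklore] -/
theorem rotZ_add_nat_mul_two_pi (θ : ℝ) (n : ℕ) : rotZ (θ + n * (2 * Real.pi)) = rotZ θ := by
  funext x
  simp only [rotZ, Real.cos_add_nat_mul_two_pi, Real.sin_add_nat_mul_two_pi]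

/-- Lipschitz dependence of `R_θ y` on the angle:
`‖R_a y - R_b y‖ ≤ (|cos a - cos b| + |sin a - sin b|) ‖y‖`. [folklore] -/
theorem norm_rotZ_sub_rotZ_le (a b : ℝ) (y : EuclideanSpace ℝ (Fin 3)) :
    ‖rotZ a y - rotZ b y‖ ≤ (|Real.cos a - Real.cos b| + |Real.sin a - Real.sin b|) * ‖y‖ := by
  rw [← sq_le_sq₀ (norm_nonneg _) (by positivity), mul_pow, EuclideanSpace.norm_sq_eq,
    EuclideanSpace.norm_sq_eq]
  simp only [Fin.sum_univ_three, Real.norm_eq_abs, sq_abs, PiLp.sub_apply, rotZ_apply_zero,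
    rotZ_apply_one, rotZ_apply_two, sub_self]
  nlinarith [mul_nonneg (mul_nonneg (abs_nonneg (Real.cos a - Real.cos b))
      (abs_nonneg (Real.sin a - Real.sin b)))
      (add_nonneg (add_nonneg (sq_nonneg (y 0)) (sq_nonneg (y 1))) (sq_nonneg (y 2))),
    mul_nonneg (add_nonneg (sq_nonneg (Real.cos a - Real.cos b))
      (sq_nonneg (Real.sin a - Real.sin b))) (sq_nonneg (y 2)),
    sq_abs (Real.cos a - Real.cos b), sq_abs (Real.sin a - Real.sin b)]

/-- The approximating angles: for `θ ≥ 0` and `q j → ∞`,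
`⌊θ / (2π / q j)⌋₊ · (2π / q j) → θ`. [folklore] -/
theorem tendsto_floor_mul_angle {q : ℕ → ℕ} (hq : Tendsto q atTop atTop) {θ : ℝ} (hθ : 0 ≤ θ) :
    Tendsto (fun j => (⌊θ / (2 * Real.pi / q j)⌋₊ : ℝ) * (2 * Real.pi / q j)) atTop (𝓝 θ) := by
  have ha : Tendsto (fun j => 2 * Real.pi / (q j : ℝ)) atTop (𝓝 0) :=
    tendsto_const_nhds.div_atTop (tendsto_natCast_atTop_atTop.comp hq)
  rw [← tendsto_sub_nhds_zero_iff]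
  refine squeeze_zero_norm' ?_ ha
  filter_upwards [hq.eventually_ge_atTop 1] with j hj
  have hapos : 0 < 2 * Real.pi / (q j : ℝ) := by
    have : (1 : ℝ) ≤ q j := by exact_mod_cast hj
    positivity
  rw [Real.norm_eq_abs, abs_sub_comm, abs_of_nonneg]
  · have h := Nat.lt_floor_add_one (θ / (2 * Real.pi / q j))
    rw [div_lt_iff₀ hapos] at h
    linarith
  · have h := Nat.floor_le (div_nonneg hθ hapos.le)
    rw [le_div_iff₀ hapos] at h
    linarith

/-! ### `L³` estimates -/

/-- `u ∘ R_θ` is a.e. strongly measurable for `u ∈ L³`. [folklore] -/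
theorem aestronglyMeasurable_comp_rotZ {u : EuclideanSpace ℝ (Fin 3) → EuclideanSpace ℝ (Fin 3)}
    (hu : MemLp u 3 volume) (θ : ℝ) :
    AEStronglyMeasurable (fun x => u (rotZ θ x)) volume :=
  hu.aestronglyMeasurable.comp_measurePreserving (measurePreserving_rotZ θ)

/-- `R_θ ∘ u` is a.e. strongly measurable for `u ∈ L³`. [folklore] -/
theorem aestronglyMeasurable_rotZ_comp {u : EuclideanSpace ℝ (Fin 3) → EuclideanSpace ℝ (Fin 3)}
    (hu : MemLp u 3 volume) (θ : ℝ) :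
    AEStronglyMeasurable (fun x => rotZ θ (u x)) volume :=
  (rotZL θ).continuous.comp_aestronglyMeasurable hu.aestronglyMeasurable

/-- The commutator of the limit is controlled by the distance to an equivariant field:
if `V ∘ R_a = R_a ∘ V` then `‖u ∘ R_a - R_a ∘ u‖₃ ≤ 2 ‖V - u‖₃` (the rotation preserves
Lebesgue measure and is a linear isometry). [folklore] -/
theorem eLpNorm_comm_le_two_mul {u V : EuclideanSpace ℝ (Fin 3) → EuclideanSpace ℝ (Fin 3)}
    (hu : MemLp u 3 volume) (hV : MemLp V 3 volume) {a : ℝ}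
    (hVa : ∀ x, V (rotZ a x) = rotZ a (V x)) :
    eLpNorm (fun x => u (rotZ a x) - rotZ a (u x)) 3 volume ≤ 2 * eLpNorm (V - u) 3 volume := by
  have hlin : ∀ x, rotZ a (V x - u x) = rotZ a (V x) - rotZ a (u x) := fun x => by
    simpa only [rotZL_apply] using map_sub (rotZL a) (V x) (u x)
  have hfun : (fun x => u (rotZ a x) - rotZ a (u x)) =
      (u - V) ∘ rotZ a + fun x => rotZ a ((V - u) x) := by
    funext x
    simp only [Pi.add_apply, Function.comp_apply, Pi.sub_apply, hVa x, hlin x]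
    abel
  have hF : AEStronglyMeasurable ((u - V) ∘ rotZ a) volume :=
    (hu.sub hV).aestronglyMeasurable.comp_measurePreserving (measurePreserving_rotZ a)
  have hG : AEStronglyMeasurable (fun x => rotZ a ((V - u) x)) volume :=
    (rotZL a).continuous.comp_aestronglyMeasurable (hV.sub hu).aestronglyMeasurable
  have hnorm : eLpNorm (fun x => rotZ a ((V - u) x)) 3 volume = eLpNorm (V - u) 3 volume :=
    eLpNorm_congr_norm_ae (Eventually.of_forall fun x => norm_rotZ a _)
  rw [hfun]
  calc eLpNorm ((u - V) ∘ rotZ a + fun x => rotZ a ((V - u) x)) 3 volume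
      ≤ eLpNorm ((u - V) ∘ rotZ a) 3 volume + eLpNorm (fun x => rotZ a ((V - u) x)) 3 volume :=
        eLpNorm_add_le hF hG (by norm_num)
    _ = eLpNorm (V - u) 3 volume + eLpNorm (V - u) 3 volume := by
        rw [eLpNorm_comp_measurePreserving (hu.sub hV).aestronglyMeasurable
          (measurePreserving_rotZ a), eLpNorm_sub_comm, hnorm]
    _ = 2 * eLpNorm (V - u) 3 volume := (two_mul _).symm

/-- Strong continuity of the rotation action on the argument: if `α j → θ` then
`‖u ∘ R_{α j} - u ∘ R_θ‖₃ → 0` for `u ∈ L³` (Mathlib: composition with a continuously varying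
measure-preserving map is continuous on `Lp`, `p < ∞`). [folklore] -/
theorem tendsto_eLpNorm_comp_rotZ_sub {u : EuclideanSpace ℝ (Fin 3) → EuclideanSpace ℝ (Fin 3)}
    (hu : MemLp u 3 volume) {α : ℕ → ℝ} {θ : ℝ} (hα : Tendsto α atTop (𝓝 θ)) :
    Tendsto (fun j => eLpNorm (fun x => u (rotZ (α j) x) - u (rotZ θ x)) 3 volume)
      atTop (𝓝 0) := by
  haveI : Fact (1 ≤ (3 : ℝ≥0∞)) := ⟨by norm_num⟩
  -- the rotations as a continuous curve in `C(ℝ³, ℝ³)` (compact-open topology)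
  let g : ℝ → C(EuclideanSpace ℝ (Fin 3), EuclideanSpace ℝ (Fin 3)) := fun t =>
    ⟨rotZ t, (rotZL t).continuous⟩
  have hg : Continuous g := by
    refine ContinuousMap.continuous_of_continuous_uncurry _ ?_
    show Continuous fun p : ℝ × EuclideanSpace ℝ (Fin 3) => rotZ p.1 p.2
    unfold rotZ
    fun_prop
  have hgm : ∀ t, MeasurePreserving (g t) (volume : Measure (EuclideanSpace ℝ (Fin 3))) volume :=
    fun t => measurePreserving_rotZ t
  have hg' : Tendsto (fun j => g (α j)) atTop (𝓝 (g θ)) := (hg.tendsto θ).comp hα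
  have key :=
    (tendsto_const_nhds (x := hu.toLp u) (f := (atTop : Filter ℕ))).compMeasurePreservingLp
      hg' (fun j => hgm (α j)) (hgm θ) (by norm_num)
  rw [Lp.tendsto_Lp_iff_tendsto_eLpNorm'] at key
  refine (tendsto_congr fun j => ?_).mp key
  refine eLpNorm_congr_ae ?_
  filter_upwards [Lp.coeFn_compMeasurePreserving (hu.toLp u) (hgm (α j)),
    Lp.coeFn_compMeasurePreserving (hu.toLp u) (hgm θ),
    (hgm (α j)).quasiMeasurePreserving.ae_eq hu.coeFn_toLp,
    (hgm θ).quasiMeasurePreserving.ae_eq hu.coeFn_toLp] with x h1 h2 h3 h4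
  rw [Pi.sub_apply, h1, h2, h3, h4]
  rfl

/-- Strong continuity of the rotation action on the values: if `α j → θ` then
`‖R_{α j} ∘ u - R_θ ∘ u‖₃ ≤ (|cos α j - cos θ| + |sin α j - sin θ|) ‖u‖₃ → 0`. [folklore] -/
theorem tendsto_eLpNorm_rotZ_comp_sub {u : EuclideanSpace ℝ (Fin 3) → EuclideanSpace ℝ (Fin 3)}
    (hu : MemLp u 3 volume) {α : ℕ → ℝ} {θ : ℝ} (hα : Tendsto α atTop (𝓝 θ)) :
    Tendsto (fun j => eLpNorm (fun x => rotZ (α j) (u x) - rotZ θ (u x)) 3 volume)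
      atTop (𝓝 0) := by
  have hε : Tendsto (fun j => |Real.cos (α j) - Real.cos θ| + |Real.sin (α j) - Real.sin θ|)
      atTop (𝓝 0) := by
    have hc : Tendsto (fun j => Real.cos (α j)) atTop (𝓝 (Real.cos θ)) :=
      (Real.continuous_cos.tendsto θ).comp hα
    have hs : Tendsto (fun j => Real.sin (α j)) atTop (𝓝 (Real.sin θ)) :=
      (Real.continuous_sin.tendsto θ).comp hα
    simpa using ((hc.sub_const (Real.cos θ)).abs).add ((hs.sub_const (Real.sin θ)).abs)
  have hbound : ∀ j, eLpNorm (fun x => rotZ (α j) (u x) - rotZ θ (u x)) 3 volume ≤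
      ENNReal.ofReal (|Real.cos (α j) - Real.cos θ| + |Real.sin (α j) - Real.sin θ|) *
        eLpNorm u 3 volume := fun j =>
    eLpNorm_le_mul_eLpNorm_of_ae_le_mul
      (Eventually.of_forall fun x => norm_rotZ_sub_rotZ_le (α j) θ (u x)) 3
  have hlim : Tendsto (fun j =>
      ENNReal.ofReal (|Real.cos (α j) - Real.cos θ| + |Real.sin (α j) - Real.sin θ|) *
        eLpNorm u 3 volume) atTop (𝓝 0) := by
    have h1 := ENNReal.tendsto_ofReal hε
    rw [ENNReal.ofReal_zero] at h1
    simpa using ENNReal.Tendsto.mul_const h1 (Or.inr hu.eLpNorm_ne_top)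
  exact tendsto_of_tendsto_of_tendsto_of_le_of_le tendsto_const_nhds hlim (fun _ => zero_le)
    hbound

/-- Four-point triangle inequality in `L³`:
`‖F - G‖₃ ≤ ‖P - Q‖₃ + ‖P - F‖₃ + ‖Q - G‖₃`. [folklore] -/
theorem eLpNorm_sub_le_of_intermediate
    {F G P Q : EuclideanSpace ℝ (Fin 3) → EuclideanSpace ℝ (Fin 3)}
    (hF : AEStronglyMeasurable F volume) (hG : AEStronglyMeasurable G volume)
    (hP : AEStronglyMeasurable P volume) (hQ : AEStronglyMeasurable Q volume) :
    eLpNorm (fun x => F x - G x) 3 volume ≤ eLpNorm (fun x => P x - Q x) 3 volume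
      + eLpNorm (fun x => P x - F x) 3 volume + eLpNorm (fun x => Q x - G x) 3 volume := by
  have h : (fun x => F x - G x) = (P - Q) - (P - F) + (Q - G) := by
    funext x
    simp only [Pi.add_apply, Pi.sub_apply]
    abel
  rw [h]
  calc eLpNorm ((P - Q) - (P - F) + (Q - G)) 3 volume
      ≤ eLpNorm ((P - Q) - (P - F)) 3 volume + eLpNorm (Q - G) 3 volume :=
        eLpNorm_add_le ((hP.sub hQ).sub (hP.sub hF)) (hQ.sub hG) (by norm_num)
    _ ≤ eLpNorm (P - Q) 3 volume + eLpNorm (P - F) 3 volume + eLpNorm (Q - G) 3 volume :=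
        add_le_add_left (eLpNorm_sub_le (hP.sub hQ) (hP.sub hF) (by norm_num)) _

/-! ### The closure argument -/

/-- The stub for a nonnegative angle `θ ≥ 0` (in `rotZ` form): an `L³` limit `u` of fields `V j`
equivariant under `R_{2π/q j}`, `q j → ∞`, is a.e. equivariant under `R_θ`. [folklore] -/
theorem ae_equivariant_of_nonneg {u : EuclideanSpace ℝ (Fin 3) → EuclideanSpace ℝ (Fin 3)}
    {q : ℕ → ℕ} {V : ℕ → EuclideanSpace ℝ (Fin 3) → EuclideanSpace ℝ (Fin 3)}
    (hu : MemLp u 3 volume) (hV : ∀ j, MemLp (V j) 3 volume) (hq : Tendsto q atTop atTop)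
    (hsym : ∀ j x, V j (rotZ (2 * Real.pi / q j) x) = rotZ (2 * Real.pi / q j) (V j x))
    (hconv : Tendsto (fun j => eLpNorm (V j - u) 3 volume) atTop (𝓝 0))
    {θ : ℝ} (hθ : 0 ≤ θ) :
    (fun x => u (rotZ θ x)) =ᵐ[volume] fun x => rotZ θ (u x) := by
  -- approximating angles `α j → θ` under which `V j` is equivariant
  obtain ⟨α, hαθ, hαV⟩ : ∃ α : ℕ → ℝ, Tendsto α atTop (𝓝 θ) ∧
      ∀ j x, V j (rotZ (α j) x) = rotZ (α j) (V j x) :=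
    ⟨fun j => (⌊θ / (2 * Real.pi / q j)⌋₊ : ℝ) * (2 * Real.pi / q j),
      tendsto_floor_mul_angle hq hθ, fun j x => equivariant_nat_mul (hsym j) _ x⟩
  -- the three vanishing sequences
  have h1 := tendsto_eLpNorm_comp_rotZ_sub hu hαθ
  have h2 := tendsto_eLpNorm_rotZ_comp_sub hu hαθ
  have h3 : Tendsto (fun j => 2 * eLpNorm (V j - u) 3 volume) atTop (𝓝 0) := by
    simpa using ENNReal.Tendsto.const_mul hconv (Or.inr ENNReal.ofNat_ne_top)
  -- the main bound
  have hmain : ∀ j, eLpNorm (fun x => u (rotZ θ x) - rotZ θ (u x)) 3 volume ≤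
      2 * eLpNorm (V j - u) 3 volume
      + eLpNorm (fun x => u (rotZ (α j) x) - u (rotZ θ x)) 3 volume
      + eLpNorm (fun x => rotZ (α j) (u x) - rotZ θ (u x)) 3 volume := fun j =>
    calc eLpNorm (fun x => u (rotZ θ x) - rotZ θ (u x)) 3 volume
        ≤ eLpNorm (fun x => u (rotZ (α j) x) - rotZ (α j) (u x)) 3 volume
          + eLpNorm (fun x => u (rotZ (α j) x) - u (rotZ θ x)) 3 volume
          + eLpNorm (fun x => rotZ (α j) (u x) - rotZ θ (u x)) 3 volume :=
          eLpNorm_sub_le_of_intermediate (aestronglyMeasurable_comp_rotZ hu θ)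
            (aestronglyMeasurable_rotZ_comp hu θ) (aestronglyMeasurable_comp_rotZ hu (α j))
            (aestronglyMeasurable_rotZ_comp hu (α j))
      _ ≤ _ := by
          gcongr
          exact eLpNorm_comm_le_two_mul hu (hV j) (hαV j)
  -- pass to the limit
  have hzero : eLpNorm (fun x => u (rotZ θ x) - rotZ θ (u x)) 3 volume = 0 := by
    refine le_antisymm ?_ zero_le
    have hsum := (h3.add h1).add h2
    simp only [add_zero] at hsum
    exact ge_of_tendsto' hsum hmain
  have hmeas : AEStronglyMeasurable (fun x => u (rotZ θ x) - rotZ θ (u x)) volume :=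
    (aestronglyMeasurable_comp_rotZ hu θ).sub (aestronglyMeasurable_rotZ_comp hu θ)
  rw [eLpNorm_eq_zero_iff hmeas (by norm_num)] at hzero
  exact eventuallyEq_iff_sub.mpr hzero

/-- **Stub 3 (closure of the dense subgroup in `L³`).** A strong `L³` limit `u` of fields `V j`
equivariant under the rotation by `2π/q j` about the `x 2`-axis with `q j → ∞` is, for EVERY angle
`θ`, almost-everywhere equivariant under `R_θ` (the angles `2πk/q j` are dense in `ℝ`; the rotation
action on `L³(ℝ³)` is strongly continuous and isometric). Harmonic analysis only; no Navier–Stokes.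
[folklore] -/
theorem stub_denseAngleClosure :
    ∀ (u : EuclideanSpace ℝ (Fin 3) → EuclideanSpace ℝ (Fin 3)) (q : ℕ → ℕ)
      (V : ℕ → EuclideanSpace ℝ (Fin 3) → EuclideanSpace ℝ (Fin 3)),
      MemLp u 3 volume → (∀ j, MemLp (V j) 3 volume) → Tendsto q atTop atTop →
      (∀ j (x : EuclideanSpace ℝ (Fin 3)),
        V j (WithLp.toLp 2 ![Real.cos (2 * Real.pi / q j) * x 0 - Real.sin (2 * Real.pi / q j) * x 1,
          Real.sin (2 * Real.pi / q j) * x 0 + Real.cos (2 * Real.pi / q j) * x 1, x 2]) =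
        WithLp.toLp 2 ![Real.cos (2 * Real.pi / q j) * V j x 0 - Real.sin (2 * Real.pi / q j) * V j x 1,
          Real.sin (2 * Real.pi / q j) * V j x 0 + Real.cos (2 * Real.pi / q j) * V j x 1, V j x 2]) →
      Tendsto (fun j => eLpNorm (V j - u) 3 volume) atTop (𝓝 0) →
      ∀ θ : ℝ,
        (fun x : EuclideanSpace ℝ (Fin 3) =>
          u (WithLp.toLp 2 ![Real.cos θ * x 0 - Real.sin θ * x 1,
            Real.sin θ * x 0 + Real.cos θ * x 1, x 2])) =ᵐ[volume]
        fun x => WithLp.toLp 2 ![Real.cos θ * u x 0 - Real.sin θ * u x 1,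
          Real.sin θ * u x 0 + Real.cos θ * u x 1, u x 2] := by
  intro u q V hu hV hq hsym hconv θ
  -- the written-out rotations ARE `rotZ` (definitionally)
  show (fun x => u (rotZ θ x)) =ᵐ[volume] fun x => rotZ θ (u x)
  have hsym' : ∀ j x, V j (rotZ (2 * Real.pi / q j) x) = rotZ (2 * Real.pi / q j) (V j x) :=
    fun j x => hsym j x
  -- reduce to a nonnegative angle by `2π`-periodicity
  obtain ⟨n, hn⟩ := exists_nat_ge (-θ / (2 * Real.pi))
  have hθ' : 0 ≤ θ + n * (2 * Real.pi) := by
    rw [div_le_iff₀ (by positivity : (0 : ℝ) < 2 * Real.pi)] at hn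
    linarith
  rw [← rotZ_add_nat_mul_two_pi θ n]
  exact ae_equivariant_of_nonneg hu hV hq hsym' hconv hθ'

end Summit.NavierStokesRegularity.NavierStokesRegularity.Theorems.PFoldToAxisymmetric.DenseAngleClosure
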